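import Mathlib
import Summits.ValiantsHypothesis.ValiantsHypothesis.Theorems.DivisionGapPerCofactorDegreeReductionStubTwoTowerCollapse

/-!
# Crux `DivisionGap.PerCofactorDegreeReduction` (stmt-ValiantsHypothesis-15046), line `Sketch` —
# stub `stub_binomialValuationBalance`: prime valuations balance in a binomial creation identity

**Theorem (`stub_binomialValuationBalance`).** Let `n ≥ 3`, let `ℓ₁, …, ℓ_r ∈ ℝ≥0[x_ij]` (`n × n`
variables), let `α, β : {1, …, r} → ℕ` be exponent vectors and `c > 0` a real constant with
`per_n ∣ ℓ^α + c ℓ^β` over `ℝ` (`ℓ^α = ∏ ℓᵢ^αᵢ`).  Then for every prime `π` of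
`S_n = ℂ[x]/(per_n)` the `π`-adic valuations of the two monomials agree:
`Σ αᵢ v_π(ℓ̄ᵢ) = Σ βᵢ v_π(ℓ̄ᵢ)` (bars: classes of the complexifications, `v_π = emultiplicity π`).

## Proof

`S_n` is a domain for `n ≥ 3` (tree theorem
`Summit.ValiantsHypothesis.Theorems.permQuot_isDomain_and_ufm`).  Reducing the hypothesis along
`Φ : ℝ≥0[x] → ℝ[x] → ℂ[x] → S_n` (`TwoTowerCollapse.per_ascent`) gives
`∏ ℓ̄ᵢ^αᵢ + c̄ ∏ ℓ̄ᵢ^βᵢ = 0`, i.e. `∏ ℓ̄ᵢ^αᵢ = w ∏ ℓ̄ᵢ^βᵢ` with `w = -c̄` a unit (`c ≠ 0` is a unit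
of `ℂ`, hence `C c` of `ℂ[x]`, hence its class; `IsUnit.neg`).  Taking `emultiplicity π` of both
sides, `emultiplicity` is additive on products and powers for a prime in a cancellative monoid
(`Finset.emultiplicity_prod`, `emultiplicity_pow`, `emultiplicity_mul`) and vanishes on units
(`emultiplicity_of_isUnit_right`).  The hypotheses `per_n ∤ ℓᵢ` of the registered signature are
not needed.
-/

noncomputable section

-- `Summit.ValiantsHypothesis.ValiantsHypothesis.…` is the tree's mandated single-conjunct layout
-- (Problem = Summit), so the duplicated namespace component is intended.
set_option linter.dupNamespace false

namespace Summit.ValiantsHypothesis.ValiantsHypothesis.Theorems.DivisionGap.PerCofactorDegreeReduction.BinomialValuationBalance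

open MvPolynomial Literature.Computability.AlgebraicComplexity
open Summit.ValiantsHypothesis.ValiantsHypothesis.Theorems.DivisionGap.PerCofactorDegreeReduction.TwoTowerCollapse
  (per_ascent)
open scoped NNReal

/-- **stub_binomialValuationBalance — prime valuations balance in a BINOMIAL CREATION IDENTITY
modulo the permanent.**  For `n ≥ 3`, light gates `ℓᵢ ∈ ℝ≥0[x_ij]`, exponent vectors `α, β` and a
real `c > 0` with `per_n ∣ ∏ ℓᵢ^αᵢ + c ∏ ℓᵢ^βᵢ` over `ℝ`, every prime `π` of `S_n = ℂ[x]/(per_n)`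
satisfies `Σ αᵢ · emultiplicity π ℓ̄ᵢ = Σ βᵢ · emultiplicity π ℓ̄ᵢ`.  Proof: in the domain `S_n`
(`Summit.ValiantsHypothesis.Theorems.permQuot_isDomain_and_ufm`) the two monomials are associated,
`∏ ℓ̄ᵢ^αᵢ = (-c̄) ∏ ℓ̄ᵢ^βᵢ` with `-c̄` a unit, and `emultiplicity π` is additive on products and
powers and vanishes on units.  The hypotheses `per_n ∤ ℓᵢ` are part of the registered signature
but unused. [prime-walk-positivizer] -/
theorem stub_binomialValuationBalance (n r : ℕ) (hn : 3 ≤ n)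
    (ℓ : Fin r → MvPolynomial (Fin n × Fin n) ℝ≥0)
    (hℓ : ∀ i, ¬ perPoly (Fin n) ℝ ∣ MvPolynomial.map NNReal.toRealHom (ℓ i))
    (α β : Fin r → ℕ) (c : ℝ≥0) (hc : 0 < c)
    (hdvd : perPoly (Fin n) ℝ ∣ MvPolynomial.map NNReal.toRealHom
      (∏ i, ℓ i ^ α i + c • ∏ i, ℓ i ^ β i))
    (π : MvPolynomial (Fin n × Fin n) ℂ ⧸ Ideal.span {perPoly (Fin n) ℂ}) (hπ : Prime π) :
    (∑ i, (α i : ℕ∞) * emultiplicity π (Ideal.Quotient.mk (Ideal.span {perPoly (Fin n) ℂ})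
        (MvPolynomial.map Complex.ofRealHom (MvPolynomial.map NNReal.toRealHom (ℓ i))))) =
      ∑ i, (β i : ℕ∞) * emultiplicity π (Ideal.Quotient.mk (Ideal.span {perPoly (Fin n) ℂ})
        (MvPolynomial.map Complex.ofRealHom (MvPolynomial.map NNReal.toRealHom (ℓ i)))) := by
  classical
  -- `hℓ` belongs to the registered signature but is not needed
  have _ := hℓ
  -- `S_n = ℂ[x]/(per_n)` is a domain (cancellative), so `emultiplicity π` is additive
  obtain ⟨hdom, _hufm⟩ := Summit.ValiantsHypothesis.Theorems.permQuot_isDomain_and_ufm hn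
  -- the reduction map `Φ : ℝ≥0[x] → ℝ[x] → ℂ[x] → S_n`
  obtain ⟨Φ, hΦdef⟩ : ∃ Φ : MvPolynomial (Fin n × Fin n) ℝ≥0 →+*
      MvPolynomial (Fin n × Fin n) ℂ ⧸ Ideal.span {perPoly (Fin n) ℂ},
      Φ = (Ideal.Quotient.mk (Ideal.span {perPoly (Fin n) ℂ})).comp
        ((MvPolynomial.map Complex.ofRealHom).comp (MvPolynomial.map NNReal.toRealHom)) :=
    ⟨_, rfl⟩
  have hΦ : ∀ p, Φ p = Ideal.Quotient.mk (Ideal.span {perPoly (Fin n) ℂ})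
      (MvPolynomial.map Complex.ofRealHom (MvPolynomial.map NNReal.toRealHom p)) := fun p => by
    rw [hΦdef]; rfl
  have hΦ0 : ∀ p, Φ p = 0 ↔ perPoly (Fin n) ℂ ∣
      MvPolynomial.map Complex.ofRealHom (MvPolynomial.map NNReal.toRealHom p) := fun p => by
    rw [hΦ, Ideal.Quotient.eq_zero_iff_mem, Ideal.mem_span_singleton]
  have hΦC : ∀ (b : ℝ≥0) (p : MvPolynomial (Fin n × Fin n) ℝ≥0),
      Φ (b • p) = Ideal.Quotient.mk (Ideal.span {perPoly (Fin n) ℂ}) (C ((b : ℝ) : ℂ)) * Φ p := by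
    intro b p
    simp only [hΦ, smul_eq_C_mul, map_mul, MvPolynomial.map_C]
    rfl
  -- the relation `∏ ℓ̄ᵢ^αᵢ + c̄ ∏ ℓ̄ᵢ^βᵢ = 0` in `S_n`
  have hrel : ∏ i, Φ (ℓ i) ^ α i +
      Ideal.Quotient.mk (Ideal.span {perPoly (Fin n) ℂ}) (C ((c : ℝ) : ℂ)) *
        ∏ i, Φ (ℓ i) ^ β i = 0 := by
    have h : Φ (∏ i, ℓ i ^ α i + c • ∏ i, ℓ i ^ β i) = 0 := (hΦ0 _).2 (per_ascent hdvd)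
    rw [map_add, hΦC, map_prod, map_prod] at h
    simpa only [map_pow] using h
  -- `w = -c̄` is a unit and `∏ ℓ̄ᵢ^αᵢ = w ∏ ℓ̄ᵢ^βᵢ`
  have hc0 : ((c : ℝ) : ℂ) ≠ 0 := Complex.ofReal_ne_zero.2 (NNReal.coe_pos.2 hc).ne'
  have hwU : IsUnit (-(Ideal.Quotient.mk (Ideal.span {perPoly (Fin n) ℂ}) (C ((c : ℝ) : ℂ)))) :=
    (((isUnit_iff_ne_zero.2 hc0).map C).map
      (Ideal.Quotient.mk (Ideal.span {perPoly (Fin n) ℂ}))).neg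
  have hassoc : ∏ i, Φ (ℓ i) ^ α i =
      -(Ideal.Quotient.mk (Ideal.span {perPoly (Fin n) ℂ}) (C ((c : ℝ) : ℂ))) *
        ∏ i, Φ (ℓ i) ^ β i := by
    linear_combination hrel
  -- take `emultiplicity π` of both sides
  have key := congr_arg (emultiplicity π) hassoc
  rw [emultiplicity_mul hπ, emultiplicity_of_isUnit_right hπ.not_unit hwU, zero_add,
    Finset.emultiplicity_prod hπ, Finset.emultiplicity_prod hπ] at key
  simp only [emultiplicity_pow hπ] at key
  simpa only [hΦ] using key

end Summit.ValiantsHypothesis.ValiantsHypothesis.Theorems.DivisionGap.PerCofactorDegreeReduction.BinomialValuationBalance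

end
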